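import Summits.BirchSwinnertonDyer.BirchSwinnertonDyer.Theses.ByReductionTypeAtTwo
import Summits.BirchSwinnertonDyer.Rank1Residual.X5.TwoAdicAdditiveL2
import Literature.NumberTheory.EllipticCurves.Kato2004.AdditivePotGoodRankZeroShaUpperBoundFineSelmerAtTwo
import Literature.NumberTheory.EllipticCurves.Rank1Residual.Typed.CasselsLowerBound
import HarnessLib

/-!
# Route `ByReductionTypeAtTwo` (rung K4), crux `AdditiveRankZeroAtTwo` (item stmt-BirchSwinnertonDyer-19098),
# line add_twist_overK v2, stub `stub_addDefectUpper` (hU3): the ∀ UPPER half on the defect-≥3 block READ THROUGH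
# Kato at `p = 2` — reduced to Coates–Sujatha's statement (A) at `(E, 2)` plus ONE factor of `2`, and the factor of
# `2` removed per class by Cassels–Tate squareness (a `--supports` file; seat `bsd-2adic-addL2x` GEN 5)

HONEST FRAMING (cell `bsd-2adic`, HUMAN RULING D-0036/D-0054): types-the-object-of; closes none at the ∀-level;
nothing booked; BSD is not proved by any of this. The item is NOT closed by this file (conditional helpers).

WHAT THIS FILE DOES. The registered stub `stub_addDefectUpper` asks, for every non-CM `r_an = 0` curve with
`AddTwoL2.DefectAtLeastThree W` (additive at `2`, not quadratically semistabilisable: 1 382 classes, all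
potentially supersingular at `2`), the upper half `MissingUpperBoundAt W 2` (`ord₂ #Ш ≤ ord₂ #Ш_an`) — lane A's
WALL «Kato 14.5 (3) prints p ≠ 2». The Literature reading
`Kato2004.rankZero_padicValNat_sha_add_padicValNat_tamagawa_le_add_one_at_two_of_negDisc_of_irreducible_of_fineSelmerDual_fg`
(file `Kato2004/AdditivePotGoodRankZeroShaUpperBoundFineSelmerAtTwo.lean`, this seat: Kato Thm 12.5 (3) λ-divisibility at
`2` via Kato 1999 Thm 0.8, moved to `Λ' = ℤ₂[[Gal(ℚ^cyc/ℚ)]]`; 13.8 / 13.14 / 14.14–14.16 verbatim for `Δ_E < 0` where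
`T₂E` is cohomologically trivial at `ℝ`; local index at an additive `2` by Tate duality; period `Ω⁺_γ = Ω_E/2`) gives, GRANTED
statement (A) at `(E,2)` (the dual fine Selmer group `Y(E/ℚ^cyc)` is `ℤ₂`-finitely generated — a HYPOTHESIS, in the tree's
`∃ γ D` spelling over `WeierstrassCurve.FineSelmerDualData`):
`ord₂ #Ш(E)[2^∞] + v₂(Tam E) ≤ ord₂(L(E,1)/Ω_E) + 1`. In Miller's currency (`#Ш_an = (L/Ω)·#tors²/Tam`, torsion term
killed by irreducibility) that is `ord₂ #Ш ≤ ord₂ #Ш_an + 1` — hU3 UP TO ONE FACTOR OF 2. Cassels–Tate (the PUB fact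
`exists_casselsTate_pairing`, tree corollary `isSquare_shaOrder_of_casselsTate`) makes `#Ш` a perfect square, so when
`ord₂ #Ш_an` is EVEN — CERTIFIED on every X5 residue class (`2⁴ ‖`, `2⁶ ‖` or `2⁸ ‖ #Ш_an`) — the `+ 1` drops:
hU3 AT THE CLASS, and with the lower certificate `2^{2k−1} ∣ #Ш` (CT-2 two-engine rows) `BSD₂(E)`.

* §1 `padicValNat_le_two_mul_of_isSquare_of_le_succ` — arithmetic: a non-zero square with `ord_p ≤ 2k + 1` has `ord_p ≤ 2k`.
* §2 `padicValRat_j_nonneg_of_defectAtLeastThree` — the block is potentially good at `2` (not quadratically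
  semistabilisable ⇒ not potentially multiplicative, `AddTwoL2.quadSemistabilisable_of_potMult`).
* §3 `padicValNat_shaOrder_le_add_one_of_katoFineSelmerAtTwo_rankZero` — the reading in Miller's currency:
  `#Ш_an = q`, `ord₂ #Ш ≤ ord₂ q + 1 − 2·ord₂ #E(ℚ)_tors` (twin of bsd-potss's
  `padicValNat_shaOrder_le_of_katoFineSelmer_rankZero`, `+ 1`, `p = 2`).
* §4 `missingUpperBoundAt_two_of_katoFineSelmerAtTwo_of_even` — hU3 AT A CURVE of the sub-block {`Δ < 0`, `E[2]`
  irreducible} from (A)`(W,2)` and an even `ord₂ #Ш_an`; `bsdp_two_of_katoFineSelmerAtTwo_of_certificates` — `BSD₂(W)` from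
  the same plus the lower certificate `2^{2k−1} ∣ #Ш(W)`.
* §5 `addDefectUpper_negDisc_irreducible_of_conjA_of_even` — the ∀ SHAPE for the tenure planner: on the sub-block, granted the
  reading, GZK, modularity and Cassels–Tate, `stub_addDefectUpper`'s conclusion follows from statement (A) at `(E,2)` and
  the evenness of `ord₂ #Ш_an` — ONE named published conjecture (Coates–Sujatha 2005, reduction-type-free) per curve instead
  of «outside print».

Binders (all BY NAME): `hKato2` = the reading (Literature, flagged
`Kato-12.5(3)-14.14-14.16-at-two-negDisc-irreducible-fineSelmer-fg-plus-one`); `hGZK` = Gross–Zagier–Kolyvagin; `hmod` =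
modularity; `hCT` = Cassels–Tate pairing (bsd.S18). Memo: `run/shared/lean/pub/bsd-2adic/addL2x/VERDICT-19098-addL2x-GEN5.md`.
Certificates for (A)`(E,2)` by class groups (Coates–Sujatha formal half → Iwasawa 1973 → Fukuda 1994 / Ferrero–Washington):
kit j289186 (evidence on the item); they are NOT consumed here (the hypothesis `hA` stays displayed).

References: [Kato2004Asterisque] Thm. 12.5 (3) (p. 222), 13.8 (pp. 227–229), 14.14 + Lemma 14.15 (pp. 243–244), Prop. 14.16 (2)
(p. 244); [Kato1999Kodai] Thm. 0.8; [CoatesSujatha2005] statement (A); [Lim2017FineSelmer] §3; [SilvermanAEC2009] Thm. X.4.14;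
[Miller2011LMS] Def. 1.1.
-/

set_option autoImplicit false
-- sibling precedent (`ByReductionTypeAtTwoAdditiveCubicResolventDescent.lean`): the directory name repeats the summit name
set_option linter.dupNamespace false

noncomputable section

open scoped Classical

namespace Summit.BirchSwinnertonDyer.BirchSwinnertonDyer.Theorems.AddKatoTwo

open WeierstrassCurve Literature.NumberTheory.EllipticCurves
  Literature.NumberTheory.EllipticCurves.Rank1Residual
  Literature.NumberTheory.EllipticCurves.Rank1Residual.Typed
  Summit.BirchSwinnertonDyer.Rank1Residual.AdditivePotMult
  Summit.BirchSwinnertonDyer.Rank1Residual.X5.AddTwoL2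

/-! ## §1 Arithmetic of squares: the `+ 1` is free -/

/-- A non-zero perfect square whose `p`-adic valuation is at most `2k + 1` has valuation at most `2k` (the valuation of a
square is even). Elementary; the UPPER-bound twin of `Typed.two_mul_le_padicValNat_of_isSquare_of_pow_dvd`. [folklore] -/
theorem padicValNat_le_two_mul_of_isSquare_of_le_succ {p n k : ℕ} [Fact p.Prime] (hsq : IsSquare n) (hn : n ≠ 0)
    (hle : (padicValNat p n : ℤ) ≤ 2 * k + 1) : (padicValNat p n : ℤ) ≤ 2 * k := by
  obtain ⟨r, rfl⟩ := hsq
  have hr : r ≠ 0 := fun h => hn (by simp [h])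
  rw [padicValNat.mul hr hr] at hle ⊢
  push_cast at hle ⊢
  omega

/-! ## §2 The defect-≥3 block is potentially good at `2` -/

/-- **Defect `≥ 3` ⇒ potentially good at `2`**: a curve that is additive at `2` and NOT quadratically semistabilisable is
not potentially multiplicative (`quadSemistabilisable_of_potMult`: a potentially multiplicative curve has a multiplicative
quadratic twist), i.e. `0 ≤ ord₂ j`. Bookkeeping over the cell's definitions. [folklore] -/
theorem padicValRat_j_nonneg_of_defectAtLeastThree (W : WeierstrassCurve ℚ) [W.IsElliptic]
    (hdef : DefectAtLeastThree W) : 0 ≤ padicValRat 2 W.j := by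
  by_contra hlt
  exact hdef.2 (quadSemistabilisable_of_potMult W ⟨hdef.1, lt_of_not_ge hlt⟩)

/-! ## §3 The reading in Miller's currency -/

/-- **Rank-`0` upper bound UP TO ONE FACTOR OF `2` from the `p = 2` fine-Selmer reading**: for a non-CM globally minimal `W`,
additive and potentially good at `2`, with `Δ < 0`, `E[2]` irreducible, `r_an = 0` and statement (A) at `(E,2)` (`hA`): `#Ш_an = q`
and `ord₂ #Ш ≤ ord₂ q + 1 − 2·ord₂ #E(ℚ)_tors` (the reading bounds `ord₂ #Ш + v₂(∏ c_ℓ)` by `ord₂(L/Ω) + 1` and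
`#Ш_an = (L/Ω)·#tors²/∏ c_ℓ`). Twin of bsd-potss's `padicValNat_shaOrder_le_of_katoFineSelmer_rankZero` at `p = 2` with `+ 1`.
[cite: Kato2004Asterisque, Thm. 12.5 (3) (p. 222), 14.14 and Lemma 14.15 (pp. 243–244), Prop. 14.16 (2) (p. 244)]
[cite: CoatesSujatha2005, statement (A)] [cite: Miller2011LMS, Def. 1.1] -/
theorem padicValNat_shaOrder_le_add_one_of_katoFineSelmerAtTwo_rankZero
    (hKato2 :
      Kato2004.rankZero_padicValNat_sha_add_padicValNat_tamagawa_le_add_one_at_two_of_negDisc_of_irreducible_of_fineSelmerDual_fg)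
    (hGZK : rank_eq_analyticRank_of_analyticRank_le_one) (hmod : hasEntireLFunction_rat)
    (W : WeierstrassCurve ℚ) [W.IsElliptic] [W.IsGloballyMinimal] (hcm : ¬ W.HasCM)
    (hgood : ¬ W.HasGoodReductionAtPrime 2) (hmult : ¬ W.HasMultiplicativeReductionAtPrime 2)
    (hpot : 0 ≤ padicValRat 2 W.j) (hΔ : W.Δ < 0) (hirr : W.HasIrreducibleModPGaloisRep 2)
    (hA : ∀ (κ : ZpExtension ℚ 2), κ.IsCyclotomic →
      ∃ (γ : Field.absoluteGaloisGroup ℚ) (D : W.FineSelmerDualData κ γ),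
        Module.Finite ℤ_[2] (RestrictScalars ℤ_[2] (IwasawaAlgebra 2) D.X))
    (hr : W.analyticRank = 0) :
    ∃ q : ℚ, shaAn W = (q : ℂ) ∧
      (padicValNat 2 W.shaOrder : ℤ) ≤ padicValRat 2 q + 1 - 2 * padicValNat 2 W.torsionOrder := by
  have hL : W.entireLFunction 1 ≠ 0 := (W.analyticRank_eq_zero_iff_holds (hmod W)).mp hr
  obtain ⟨hmw, hfin⟩ := hGZK W (by rw [hr]; exact zero_le_one)
  haveI : Finite W.sha := hfin
  have hmw0 : W.mordellWeilRank = 0 := by rw [hmw, hr]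
  obtain ⟨q₀, hq₀, hle⟩ := hKato2 W hcm hgood hmult hpot hΔ hirr hA hL hfin
  have hΩpos : 0 < W.realPeriodRat := W.realPeriodRat_pos_holds
  have hΩ : (W.realPeriodRat : ℂ) ≠ 0 := by exact_mod_cast hΩpos.ne'
  have hc0 : 0 < W.tamagawaProduct := W.tamagawaProduct_pos_holds
  have ht0 : 0 < W.torsionOrder := W.torsionOrder_pos_holds
  have hq₀0 : q₀ ≠ 0 := by
    rintro rfl
    rw [Rat.cast_zero, div_eq_zero_iff] at hq₀
    exact hq₀.elim hL hΩ
  refine ⟨q₀ * (W.torsionOrder : ℚ) ^ 2 / (W.tamagawaProduct : ℚ), ?_, ?_⟩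
  · have hLq : W.entireLFunction 1 = (q₀ : ℂ) * (W.realPeriodRat : ℂ) := by
      rw [← hq₀, div_mul_cancel₀ _ hΩ]
    rw [shaAn_def, leadingLCoeff_eq_of_analyticRank_eq_zero W hr,
      W.regulator_eq_one_of_rank_zero hmw0, hLq]
    push_cast
    field_simp
  · have ht : (W.torsionOrder : ℚ) ≠ 0 := by exact_mod_cast ht0.ne'
    have hcq : (W.tamagawaProduct : ℚ) ≠ 0 := by exact_mod_cast hc0.ne'
    have hsha : padicValNat 2 (Nat.card (AddCommGroup.primaryComponent W.sha 2)) =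
        padicValNat 2 W.shaOrder := by
      unfold WeierstrassCurve.shaOrder
      exact padicValNat_card_addPrimaryComponent 2
    have hv : padicValRat 2 (q₀ * (W.torsionOrder : ℚ) ^ 2 / (W.tamagawaProduct : ℚ)) =
        padicValRat 2 q₀ + 2 * (padicValNat 2 W.torsionOrder : ℤ) -
          (padicValNat 2 W.tamagawaProduct : ℤ) := by
      rw [padicValRat.div (mul_ne_zero hq₀0 (pow_ne_zero 2 ht)) hcq,
        padicValRat.mul hq₀0 (pow_ne_zero 2 ht), pow_two, padicValRat.mul ht ht,
        padicValRat.of_nat, padicValRat.of_nat]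
      ring
    rw [hv, ← hsha]
    linarith

/-! ## §4 hU3 and BSD₂ AT A CURVE of the sub-block {Δ < 0, E[2] irreducible} -/

/-- **hU3 at a curve from statement (A) at `(E,2)` and an even `ord₂ #Ш_an`.** On the sub-block {`Δ < 0`, `E[2]` irreducible}
of the defect-≥3 block (additive at `2`, potentially good by `padicValRat_j_nonneg_of_defectAtLeastThree`), granted the `p = 2`
reading, GZK, modularity and the Cassels–Tate pairing: if `#Ш_an = q` with `ord₂ q = 2k` and (A) holds at `(W,2)`, then
`MissingUpperBoundAt W 2`. The reading gives `ord₂ #Ш ≤ 2k + 1` (torsion term `0` by irreducibility); `#Ш` is a square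
(`isSquare_shaOrder_of_casselsTate`), so `ord₂ #Ш ≤ 2k = ord₂ q`.
[cite: Kato2004Asterisque, Thm. 12.5 (3) (p. 222), 14.14 (p. 243), Prop. 14.16 (2) (p. 244)] [cite: SilvermanAEC2009, Thm. X.4.14]
[cite: CoatesSujatha2005, statement (A)] [cite: Miller2011LMS, Def. 1.1] -/
theorem missingUpperBoundAt_two_of_katoFineSelmerAtTwo_of_even
    (hKato2 :
      Kato2004.rankZero_padicValNat_sha_add_padicValNat_tamagawa_le_add_one_at_two_of_negDisc_of_irreducible_of_fineSelmerDual_fg)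
    (hGZK : rank_eq_analyticRank_of_analyticRank_le_one) (hmod : hasEntireLFunction_rat)
    (hCT : exists_casselsTate_pairing (K := ℚ))
    (W : WeierstrassCurve ℚ) [W.IsElliptic] [W.IsGloballyMinimal] (hcm : ¬ W.HasCM) (hr : W.analyticRank = 0)
    (hdef : DefectAtLeastThree W) (hΔ : W.Δ < 0) (hirr : W.HasIrreducibleModPGaloisRep 2)
    (hA : ∀ (κ : ZpExtension ℚ 2), κ.IsCyclotomic →
      ∃ (γ : Field.absoluteGaloisGroup ℚ) (D : W.FineSelmerDualData κ γ),
        Module.Finite ℤ_[2] (RestrictScalars ℤ_[2] (IwasawaAlgebra 2) D.X))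
    {q : ℚ} (hq : shaAn W = (q : ℂ)) {k : ℕ} (hk : padicValRat 2 q = 2 * k) :
    MissingUpperBoundAt W 2 := by
  obtain ⟨q', hq', hle⟩ :=
    padicValNat_shaOrder_le_add_one_of_katoFineSelmerAtTwo_rankZero hKato2 hGZK hmod W hcm hdef.1.1 hdef.1.2
      (padicValRat_j_nonneg_of_defectAtLeastThree W hdef) hΔ hirr hA hr
  have hqq : q' = q := by exact_mod_cast hq'.symm.trans hq
  subst hqq
  rw [padicValNat_torsionOrder_eq_zero_of_irreducible W 2 hirr, hk] at hle
  simp only [Nat.cast_zero, mul_zero, sub_zero] at hle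
  have hfin : W.ShaFinite := (hGZK W (by rw [hr]; exact zero_le_one)).2
  have hsq : IsSquare W.shaOrder := isSquare_shaOrder_of_casselsTate hCT W hfin
  have hn : W.shaOrder ≠ 0 := (WeierstrassCurve.shaOrder_pos W hfin).ne'
  exact ⟨q', hq', by rw [hk]; exact padicValNat_le_two_mul_of_isSquare_of_le_succ hsq hn hle⟩

/-- **BSD₂ at a curve of the sub-block from statement (A) at `(E,2)` and the two certificates** (`#Ш_an = q` with
`ord₂ q = 2k` — the analytic certificate; `2^{2k−1} ∣ #Ш` — the descent / two-engine lower certificate): the upper half by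
`missingUpperBoundAt_two_of_katoFineSelmerAtTwo_of_even`, the lower half by Cassels–Tate squareness
(`missingLowerBoundAt_of_casselsTate_of_pow_dvd`), then `bsdp_of_missingPPartAt`. Inputs BY NAME: the `p = 2` reading (flagged),
GZK, modularity, Cassels–Tate; the HYPOTHESIS (A) at `(W,2)` stays displayed.
[cite: Kato2004Asterisque, Thm. 12.5 (3) (p. 222), 14.14 (p. 243), Prop. 14.16 (2) (p. 244)] [cite: SilvermanAEC2009, Thm. X.4.14]
[cite: CoatesSujatha2005, statement (A)] [cite: Miller2011LMS, §1 and Def. 1.1] -/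
theorem bsdp_two_of_katoFineSelmerAtTwo_of_certificates
    (hKato2 :
      Kato2004.rankZero_padicValNat_sha_add_padicValNat_tamagawa_le_add_one_at_two_of_negDisc_of_irreducible_of_fineSelmerDual_fg)
    (hGZK : rank_eq_analyticRank_of_analyticRank_le_one) (hmod : hasEntireLFunction_rat)
    (hCT : exists_casselsTate_pairing (K := ℚ))
    (W : WeierstrassCurve ℚ) [W.IsElliptic] [W.IsGloballyMinimal] (hcm : ¬ W.HasCM) (hr : W.analyticRank = 0)
    (hdef : DefectAtLeastThree W) (hΔ : W.Δ < 0) (hirr : W.HasIrreducibleModPGaloisRep 2)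
    (hA : ∀ (κ : ZpExtension ℚ 2), κ.IsCyclotomic →
      ∃ (γ : Field.absoluteGaloisGroup ℚ) (D : W.FineSelmerDualData κ γ),
        Module.Finite ℤ_[2] (RestrictScalars ℤ_[2] (IwasawaAlgebra 2) D.X))
    {q : ℚ} (hq : shaAn W = (q : ℂ)) {k : ℕ} (hk : padicValRat 2 q = 2 * k)
    (hdvd : 2 ^ (2 * k - 1) ∣ W.shaOrder) : BSDp W 2 := by
  have hr1 : W.analyticRank ≤ 1 := by rw [hr]; exact zero_le_one
  have hfin : W.ShaFinite := (hGZK W hr1).2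
  exact bsdp_of_missingPPartAt W 2 hGZK hr1
    (missingPPartAt_of_lower_of_upper W 2
      (missingLowerBoundAt_of_casselsTate_of_pow_dvd W 2 hCT hfin hq (by rw [hk]) hdvd)
      (missingUpperBoundAt_two_of_katoFineSelmerAtTwo_of_even hKato2 hGZK hmod hCT W hcm hr hdef hΔ hirr hA hq hk))

/-! ## §5 The ∀ shape on the sub-block (for the tenure planner) -/

/-- **The stub `stub_addDefectUpper` (hU3) on the sub-block {`Δ < 0`, `E[2]` irreducible}, REDUCED TO ONE NAMED CONJECTURE PER
CURVE.** Granted the `p = 2` reading of Kato (flagged Literature fact), GZK, modularity and the Cassels–Tate pairing: for every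
non-CM `r_an = 0` curve of the defect-≥3 block with negative discriminant and irreducible `E[2]`, statement (A) of Coates–Sujatha at
`(E, 2)` together with the evenness of `ord₂ #Ш_an` implies `MissingUpperBoundAt W 2` — the conclusion of `stub_addDefectUpper` at
`W`. Nothing about (A) or the reading is asserted (conditional; the stub and the item are NOT closed by this theorem).
[cite: Kato2004Asterisque, Thm. 12.5 (3) (p. 222), 14.14 (p. 243), Prop. 14.16 (2) (p. 244)] [cite: CoatesSujatha2005, statement (A)]
[cite: SilvermanAEC2009, Thm. X.4.14] [cite: Miller2011LMS, Def. 1.1] -/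
theorem addDefectUpper_negDisc_irreducible_of_conjA_of_even
    (hKato2 :
      Kato2004.rankZero_padicValNat_sha_add_padicValNat_tamagawa_le_add_one_at_two_of_negDisc_of_irreducible_of_fineSelmerDual_fg)
    (hGZK : rank_eq_analyticRank_of_analyticRank_le_one) (hmod : hasEntireLFunction_rat)
    (hCT : exists_casselsTate_pairing (K := ℚ)) :
    ∀ (W : WeierstrassCurve ℚ) [W.IsElliptic] [W.IsGloballyMinimal], ¬ W.HasCM → W.analyticRank = 0 →
      DefectAtLeastThree W → W.Δ < 0 → W.HasIrreducibleModPGaloisRep 2 →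
      (∀ (κ : ZpExtension ℚ 2), κ.IsCyclotomic →
        ∃ (γ : Field.absoluteGaloisGroup ℚ) (D : W.FineSelmerDualData κ γ),
          Module.Finite ℤ_[2] (RestrictScalars ℤ_[2] (IwasawaAlgebra 2) D.X)) →
      (∃ (q : ℚ) (k : ℕ), shaAn W = (q : ℂ) ∧ padicValRat 2 q = 2 * k) →
      MissingUpperBoundAt W 2 := by
  intro W _ _ hcm hr hdef hΔ hirr hA heven
  obtain ⟨q, k, hq, hk⟩ := heven
  exact missingUpperBoundAt_two_of_katoFineSelmerAtTwo_of_even hKato2 hGZK hmod hCT W hcm hr hdef hΔ hirr hA hq hk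

/-! ## §6 APPEND (same seat, same GEN): the Δ-FREE versions, through the second Literature reading
`Kato2004.rankZero_padicValNat_sha_add_padicValNat_tamagawa_le_add_one_at_two_of_irreducible_of_fineSelmerDual_fg`
(archimedean bookkeeping for `Δ_E > 0`; flag `Kato-12.5(3)-14.14-at-two-anyDisc-irreducible-fineSelmer-fg-plus-one`).
Same shapes as §3–§5 with the hypothesis `W.Δ < 0` dropped; the binder is `hKato2'` (the Δ-free reading). -/

/-- **§3′ — the Δ-free reading in Miller's currency**: for a non-CM globally minimal `W`, additive and potentially good at
`2`, with `E[2]` irreducible, `r_an = 0` and statement (A) at `(E,2)`: `#Ш_an = q` and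
`ord₂ #Ш ≤ ord₂ q + 1 − 2·ord₂ #E(ℚ)_tors`. [cite: Kato2004Asterisque, Thm. 12.5 (3) (p. 222), 14.14 and Lemma 14.15 (pp. 243–244)]
[cite: Rubin2000, Thm. I.7.3] [cite: CoatesSujatha2005, statement (A)] [cite: Miller2011LMS, Def. 1.1] -/
theorem padicValNat_shaOrder_le_add_one_of_katoFineSelmerAtTwo_rankZero'
    (hKato2' :
      Kato2004.rankZero_padicValNat_sha_add_padicValNat_tamagawa_le_add_one_at_two_of_irreducible_of_fineSelmerDual_fg)
    (hGZK : rank_eq_analyticRank_of_analyticRank_le_one) (hmod : hasEntireLFunction_rat)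
    (W : WeierstrassCurve ℚ) [W.IsElliptic] [W.IsGloballyMinimal] (hcm : ¬ W.HasCM)
    (hgood : ¬ W.HasGoodReductionAtPrime 2) (hmult : ¬ W.HasMultiplicativeReductionAtPrime 2)
    (hpot : 0 ≤ padicValRat 2 W.j) (hirr : W.HasIrreducibleModPGaloisRep 2)
    (hA : ∀ (κ : ZpExtension ℚ 2), κ.IsCyclotomic →
      ∃ (γ : Field.absoluteGaloisGroup ℚ) (D : W.FineSelmerDualData κ γ),
        Module.Finite ℤ_[2] (RestrictScalars ℤ_[2] (IwasawaAlgebra 2) D.X))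
    (hr : W.analyticRank = 0) :
    ∃ q : ℚ, shaAn W = (q : ℂ) ∧
      (padicValNat 2 W.shaOrder : ℤ) ≤ padicValRat 2 q + 1 - 2 * padicValNat 2 W.torsionOrder := by
  have hL : W.entireLFunction 1 ≠ 0 := (W.analyticRank_eq_zero_iff_holds (hmod W)).mp hr
  obtain ⟨hmw, hfin⟩ := hGZK W (by rw [hr]; exact zero_le_one)
  haveI : Finite W.sha := hfin
  have hmw0 : W.mordellWeilRank = 0 := by rw [hmw, hr]
  obtain ⟨q₀, hq₀, hle⟩ := hKato2' W hcm hgood hmult hpot hirr hA hL hfin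
  have hΩpos : 0 < W.realPeriodRat := W.realPeriodRat_pos_holds
  have hΩ : (W.realPeriodRat : ℂ) ≠ 0 := by exact_mod_cast hΩpos.ne'
  have hc0 : 0 < W.tamagawaProduct := W.tamagawaProduct_pos_holds
  have ht0 : 0 < W.torsionOrder := W.torsionOrder_pos_holds
  have hq₀0 : q₀ ≠ 0 := by
    rintro rfl
    rw [Rat.cast_zero, div_eq_zero_iff] at hq₀
    exact hq₀.elim hL hΩ
  refine ⟨q₀ * (W.torsionOrder : ℚ) ^ 2 / (W.tamagawaProduct : ℚ), ?_, ?_⟩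
  · have hLq : W.entireLFunction 1 = (q₀ : ℂ) * (W.realPeriodRat : ℂ) := by
      rw [← hq₀, div_mul_cancel₀ _ hΩ]
    rw [shaAn_def, leadingLCoeff_eq_of_analyticRank_eq_zero W hr,
      W.regulator_eq_one_of_rank_zero hmw0, hLq]
    push_cast
    field_simp
  · have ht : (W.torsionOrder : ℚ) ≠ 0 := by exact_mod_cast ht0.ne'
    have hcq : (W.tamagawaProduct : ℚ) ≠ 0 := by exact_mod_cast hc0.ne'
    have hsha : padicValNat 2 (Nat.card (AddCommGroup.primaryComponent W.sha 2)) =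
        padicValNat 2 W.shaOrder := by
      unfold WeierstrassCurve.shaOrder
      exact padicValNat_card_addPrimaryComponent 2
    have hv : padicValRat 2 (q₀ * (W.torsionOrder : ℚ) ^ 2 / (W.tamagawaProduct : ℚ)) =
        padicValRat 2 q₀ + 2 * (padicValNat 2 W.torsionOrder : ℤ) -
          (padicValNat 2 W.tamagawaProduct : ℤ) := by
      rw [padicValRat.div (mul_ne_zero hq₀0 (pow_ne_zero 2 ht)) hcq,
        padicValRat.mul hq₀0 (pow_ne_zero 2 ht), pow_two, padicValRat.mul ht ht,
        padicValRat.of_nat, padicValRat.of_nat]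
      ring
    rw [hv, ← hsha]
    linarith

/-- **§4′ — hU3 at a curve of the sub-block {E[2] irreducible} (any sign of Δ)** from (A)`(W,2)` and an even
`ord₂ #Ш_an`, through the Δ-free reading; squareness removes the `+ 1`.
[cite: Kato2004Asterisque, Thm. 12.5 (3) (p. 222), 14.14 (p. 243)] [cite: Rubin2000, Thm. I.7.3]
[cite: SilvermanAEC2009, Thm. X.4.14] [cite: CoatesSujatha2005, statement (A)] [cite: Miller2011LMS, Def. 1.1] -/
theorem missingUpperBoundAt_two_of_katoFineSelmerAtTwo_of_even'
    (hKato2' :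
      Kato2004.rankZero_padicValNat_sha_add_padicValNat_tamagawa_le_add_one_at_two_of_irreducible_of_fineSelmerDual_fg)
    (hGZK : rank_eq_analyticRank_of_analyticRank_le_one) (hmod : hasEntireLFunction_rat)
    (hCT : exists_casselsTate_pairing (K := ℚ))
    (W : WeierstrassCurve ℚ) [W.IsElliptic] [W.IsGloballyMinimal] (hcm : ¬ W.HasCM) (hr : W.analyticRank = 0)
    (hdef : DefectAtLeastThree W) (hirr : W.HasIrreducibleModPGaloisRep 2)
    (hA : ∀ (κ : ZpExtension ℚ 2), κ.IsCyclotomic →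
      ∃ (γ : Field.absoluteGaloisGroup ℚ) (D : W.FineSelmerDualData κ γ),
        Module.Finite ℤ_[2] (RestrictScalars ℤ_[2] (IwasawaAlgebra 2) D.X))
    {q : ℚ} (hq : shaAn W = (q : ℂ)) {k : ℕ} (hk : padicValRat 2 q = 2 * k) :
    MissingUpperBoundAt W 2 := by
  obtain ⟨q', hq', hle⟩ :=
    padicValNat_shaOrder_le_add_one_of_katoFineSelmerAtTwo_rankZero' hKato2' hGZK hmod W hcm hdef.1.1 hdef.1.2
      (padicValRat_j_nonneg_of_defectAtLeastThree W hdef) hirr hA hr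
  have hqq : q' = q := by exact_mod_cast hq'.symm.trans hq
  subst hqq
  rw [padicValNat_torsionOrder_eq_zero_of_irreducible W 2 hirr, hk] at hle
  simp only [Nat.cast_zero, mul_zero, sub_zero] at hle
  have hfin : W.ShaFinite := (hGZK W (by rw [hr]; exact zero_le_one)).2
  have hsq : IsSquare W.shaOrder := isSquare_shaOrder_of_casselsTate hCT W hfin
  have hn : W.shaOrder ≠ 0 := (WeierstrassCurve.shaOrder_pos W hfin).ne'
  exact ⟨q', hq', by rw [hk]; exact padicValNat_le_two_mul_of_isSquare_of_le_succ hsq hn hle⟩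

/-- **§4′ — BSD₂ at a curve of the sub-block {E[2] irreducible} (any sign of Δ)** from (A)`(W,2)` and the two
certificates (`#Ш_an = q` with `ord₂ q = 2k`; `2^{2k−1} ∣ #Ш`), through the Δ-free reading.
[cite: Kato2004Asterisque, Thm. 12.5 (3) (p. 222), 14.14 (p. 243)] [cite: Rubin2000, Thm. I.7.3]
[cite: SilvermanAEC2009, Thm. X.4.14] [cite: CoatesSujatha2005, statement (A)] [cite: Miller2011LMS, §1 and Def. 1.1] -/
theorem bsdp_two_of_katoFineSelmerAtTwo_of_certificates'
    (hKato2' :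
      Kato2004.rankZero_padicValNat_sha_add_padicValNat_tamagawa_le_add_one_at_two_of_irreducible_of_fineSelmerDual_fg)
    (hGZK : rank_eq_analyticRank_of_analyticRank_le_one) (hmod : hasEntireLFunction_rat)
    (hCT : exists_casselsTate_pairing (K := ℚ))
    (W : WeierstrassCurve ℚ) [W.IsElliptic] [W.IsGloballyMinimal] (hcm : ¬ W.HasCM) (hr : W.analyticRank = 0)
    (hdef : DefectAtLeastThree W) (hirr : W.HasIrreducibleModPGaloisRep 2)
    (hA : ∀ (κ : ZpExtension ℚ 2), κ.IsCyclotomic →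
      ∃ (γ : Field.absoluteGaloisGroup ℚ) (D : W.FineSelmerDualData κ γ),
        Module.Finite ℤ_[2] (RestrictScalars ℤ_[2] (IwasawaAlgebra 2) D.X))
    {q : ℚ} (hq : shaAn W = (q : ℂ)) {k : ℕ} (hk : padicValRat 2 q = 2 * k)
    (hdvd : 2 ^ (2 * k - 1) ∣ W.shaOrder) : BSDp W 2 := by
  have hr1 : W.analyticRank ≤ 1 := by rw [hr]; exact zero_le_one
  have hfin : W.ShaFinite := (hGZK W hr1).2
  exact bsdp_of_missingPPartAt W 2 hGZK hr1
    (missingPPartAt_of_lower_of_upper W 2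
      (missingLowerBoundAt_of_casselsTate_of_pow_dvd W 2 hCT hfin hq (by rw [hk]) hdvd)
      (missingUpperBoundAt_two_of_katoFineSelmerAtTwo_of_even' hKato2' hGZK hmod hCT W hcm hr hdef hirr hA hq hk))

/-- **§5′ — the stub `stub_addDefectUpper` (hU3) on the sub-block {E[2] irreducible} (any sign of Δ), REDUCED TO ONE
NAMED CONJECTURE PER CURVE.** Granted the Δ-free `p = 2` reading of Kato, GZK, modularity and the Cassels–Tate pairing:
for every non-CM `r_an = 0` curve of the defect-≥3 block with irreducible `E[2]`, statement (A) of Coates–Sujatha at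
`(E, 2)` together with the evenness of `ord₂ #Ш_an` implies `MissingUpperBoundAt W 2`. Conditional; nothing asserted.
[cite: Kato2004Asterisque, Thm. 12.5 (3) (p. 222), 14.14 (p. 243)] [cite: Rubin2000, Thm. I.7.3]
[cite: CoatesSujatha2005, statement (A)] [cite: SilvermanAEC2009, Thm. X.4.14] [cite: Miller2011LMS, Def. 1.1] -/
theorem addDefectUpper_irreducible_of_conjA_of_even
    (hKato2' :
      Kato2004.rankZero_padicValNat_sha_add_padicValNat_tamagawa_le_add_one_at_two_of_irreducible_of_fineSelmerDual_fg)
    (hGZK : rank_eq_analyticRank_of_analyticRank_le_one) (hmod : hasEntireLFunction_rat)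
    (hCT : exists_casselsTate_pairing (K := ℚ)) :
    ∀ (W : WeierstrassCurve ℚ) [W.IsElliptic] [W.IsGloballyMinimal], ¬ W.HasCM → W.analyticRank = 0 →
      DefectAtLeastThree W → W.HasIrreducibleModPGaloisRep 2 →
      (∀ (κ : ZpExtension ℚ 2), κ.IsCyclotomic →
        ∃ (γ : Field.absoluteGaloisGroup ℚ) (D : W.FineSelmerDualData κ γ),
          Module.Finite ℤ_[2] (RestrictScalars ℤ_[2] (IwasawaAlgebra 2) D.X)) →
      (∃ (q : ℚ) (k : ℕ), shaAn W = (q : ℂ) ∧ padicValRat 2 q = 2 * k) →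
      MissingUpperBoundAt W 2 := by
  intro W _ _ hcm hr hdef hirr hA heven
  obtain ⟨q, k, hq, hk⟩ := heven
  exact missingUpperBoundAt_two_of_katoFineSelmerAtTwo_of_even' hKato2' hGZK hmod hCT W hcm hr hdef hirr hA hq hk

/-- The Δ-free reading implies the `Δ < 0` one (it has one hypothesis fewer), so every §3–§5 consumer is also fed by
`hKato2'`. Bookkeeping. [cite: Kato2004Asterisque, Thm. 12.5 (3) (p. 222)] -/
theorem katoFineSelmerAtTwo_negDisc_of_anyDisc
    (h : Kato2004.rankZero_padicValNat_sha_add_padicValNat_tamagawa_le_add_one_at_two_of_irreducible_of_fineSelmerDual_fg) :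
    Kato2004.rankZero_padicValNat_sha_add_padicValNat_tamagawa_le_add_one_at_two_of_negDisc_of_irreducible_of_fineSelmerDual_fg :=
  fun W _ _ hcm hgood hmult hpot _ hirr hA hL hfin => h W hcm hgood hmult hpot hirr hA hL hfin

end Summit.BirchSwinnertonDyer.BirchSwinnertonDyer.Theorems.AddKatoTwo

end
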